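import Summits.BirchSwinnertonDyer.BirchSwinnertonDyer.Theorems.KolyvaginRoadThreeMethod2Eigen
import Literature.NumberTheory.EllipticCurves.BSDRankZeroDensity
import HarnessLib

/-!
# Route `KolyvaginRoadThree`, deciding crux `ZhangSharpFrameAtThreeHL` (item stmt-BirchSwinnertonDyer-19574):
# (A6⁰) of the METHOD skeleton `Method2` AT THE BOTTOM LEVEL, reduced to the Mordell–Weil rank
# (cell `bsd-stepL`, seat `bsd-stepL-zhang3-p1` g5; `--supports stmt-BirchSwinnertonDyer-19574`, helper)

Stub A (`stub_levelRaisingAtThree`) of the registered skeleton (v2t, plan g26 17:02Z) asks, at every even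
admissible level `n`, that the canonical total rank `dim SelQ n ⁺ + dim SelQ n ⁻` be non-zero ((A6⁰); W. Zhang 2014
Thm 7.1 + root number −1). At the bottom level `n = ∅` this is no deeper than the Mordell–Weil rank of `E/K`:

* `finrank_selQ_empty_add_ne_zero_of_mordellWeilRank_ne_zero` — if `rank E(K) ≠ 0` then
  `dim SelQ ∅ ⁺ + dim SelQ ∅ ⁻ ≠ 0` (the sum is `dim_𝔽₃ Sel₃(E/K)`, `finrank_selmer_eq_finrank_selQ_add`, and
  `Sel₃(E/K) = 0` forces rank `0` by the Kummer injection `E(K)/3E(K) ↪ Sel₃(E/K)` — tree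
  `mordellWeilRank_eq_zero_and_torsionBy_eq_bot_of_selmerGroup_eq_bot`);
* `finrank_selQ_empty_add_ne_zero_of_not_isOfFinAddOrder` — the same from ONE point of infinite order in `E(K)`
  (on a Hoffstein–Luo frame: the Heegner point `y_K`, by Gross–Zagier — a named fact the stub prover supplies).

HONEST FRAMING. Consequences of landed tree theorems; no named fact, no `sorry`, 0 defs. PARTITION: O2@3 (B10) × A1
× crux 19574 — none (the n = ∅ instance of (A6⁰) modulo rank ≥ 1; T7). [cite: WZhang2014, Thm. 7.1 (r = 0 does not
occur)] [cite: SilvermanAEC2009, Thm X.4.2(a)]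
-/

noncomputable section

open scoped Classical

namespace Summit.BirchSwinnertonDyer.Rank1Residual.X11b.Three.Koly.Method2

open WeierstrassCurve NumberField IsDedekindDomain
  Literature.NumberTheory.EllipticCurves Literature.NumberTheory.GaloisRepresentations Module

variable (W : WeierstrassCurve ℚ) (K : Type) [Field K] [NumberField K] [W.IsElliptic] [W.IsGloballyMinimal]

/-- **(A6⁰) at the bottom level from the Mordell–Weil rank**: for `K` imaginary quadratic, `c` an involution of
`K`, and `rank E(K) ≠ 0`, the canonical total rank at level `∅` is non-zero:
`dim SelQ ∅ ⁺ + dim SelQ ∅ ⁻ = dim_𝔽₃ Sel₃(E/K) ≠ 0`, since `Sel₃(E/K) = 0` would force `rank E(K) = 0` through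
the Kummer injection `E(K)/3E(K) ↪ Sel₃(E/K)`. [cite: SilvermanAEC2009, Thm X.4.2(a)] -/
theorem finrank_selQ_empty_add_ne_zero_of_mordellWeilRank_ne_zero [Module (ZMod 3) (V3 W K)]
    (hK : IsImaginaryQuadratic K) (c : K ≃ₐ[ℚ] K) (hc : c * c = 1)
    (hr : (W.baseChange K).mordellWeilRank ≠ 0) :
    finrank (ZMod 3) (SelQ W K c ∅ true) + finrank (ZMod 3) (SelQ W K c ∅ false) ≠ 0 := by
  rw [← finrank_selmer_eq_finrank_selQ_add W K hK c hc]
  have hN3 : (((3 ^ 1 : ℕ) : ℤ)) ≠ 0 := by norm_num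
  haveI : Finite (selmerGroup (W.baseChange K) ((3 ^ 1 : ℕ) : ℤ)) :=
    (W.baseChange K).finite_selmerGroup_holds hN3
  haveI : Finite (AddSubgroup.toZModSubmodule 3 (selmerGroup (W.baseChange K) ((3 ^ 1 : ℕ) : ℤ))) :=
    Finite.of_equiv _ (Equiv.setCongr (AddSubgroup.coe_toZModSubmodule 3 _).symm)
  haveI : Module.Finite (ZMod 3)
      (AddSubgroup.toZModSubmodule 3 (selmerGroup (W.baseChange K) ((3 ^ 1 : ℕ) : ℤ))) :=
    Module.Finite.of_finite
  intro h0
  rw [Submodule.finrank_eq_zero] at h0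
  have hbot : selmerGroup (W.baseChange K) ((3 ^ 1 : ℕ) : ℤ) = ⊥ := by
    have := (AddSubgroup.toZModSubmodule 3).injective
      (h0.trans ((AddSubgroup.toZModSubmodule 3).map_bot).symm)
    exact this
  -- `Sel₃(E/K) = 0 ⇒ rank E(K) = 0`
  have h3 : selmerGroup (W.baseChange K) ((3 : ℕ) : ℤ) = ⊥ := hbot
  exact hr (mordellWeilRank_eq_zero_and_torsionBy_eq_bot_of_selmerGroup_eq_bot (W.baseChange K) 3 h3).1

/-- **(A6⁰) at the bottom level from one point of infinite order** (on a Hoffstein–Luo frame: the Heegner point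
`y_K`, non-torsion by Gross–Zagier): `dim SelQ ∅ ⁺ + dim SelQ ∅ ⁻ ≠ 0`. Mordell–Weil (tree
`module_finite_point_holds`) makes `rank E(K) = 0 ⟺ E(K) torsion`. [cite: SilvermanAEC2009, Thm X.4.2(a)] -/
theorem finrank_selQ_empty_add_ne_zero_of_not_isOfFinAddOrder [Module (ZMod 3) (V3 W K)]
    (hK : IsImaginaryQuadratic K) (c : K ≃ₐ[ℚ] K) (hc : c * c = 1)
    {P : (W.baseChange K).toAffine.Point} (hP : ¬ IsOfFinAddOrder P) :
    finrank (ZMod 3) (SelQ W K c ∅ true) + finrank (ZMod 3) (SelQ W K c ∅ false) ≠ 0 := by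
  refine finrank_selQ_empty_add_ne_zero_of_mordellWeilRank_ne_zero W K hK c hc fun hr ↦ hP ?_
  haveI : Module.Finite ℤ (W.baseChange K).toAffine.Point := (W.baseChange K).module_finite_point_holds
  have htors : Module.IsTorsion ℤ (W.baseChange K).toAffine.Point := by
    rw [← Module.finrank_eq_zero_iff_isTorsion]
    exact hr
  obtain ⟨n, hn⟩ := @htors P
  rw [isOfFinAddOrder_iff_zsmul_eq_zero]
  exact ⟨n.1, mem_nonZeroDivisors_iff_ne_zero.mp n.2, hn⟩

end Summit.BirchSwinnertonDyer.Rank1Residual.X11b.Three.Koly.Method2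

end
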